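import Mathlib.Analysis.Distribution.SchwartzSpace.Fourier
import Mathlib.MeasureTheory.Integral.IntegralEqImproper
import Literature.MathematicalPhysics.QuantumLattice.SpectralFilterProofs
import HarnessLib

/-!
# The weight of Hastings' spectral-flow generator (tail-integrated filter)

Seventh file of the formalisation of the Michalakis–Zwolak stability theorem (hubbard.S19). From a
filter function `w ∈ 𝓢(ℝ)` (`exists_schwartz_filter`: `∫ w = 1`, `∫ e^{itΔ} w(t) dt = 0` for
`|Δ| ≥ γ`, real values) one builds the weight

`W(t) = ∫_t^∞ w (t ≥ 0)`, `W(t) = −∫_{−∞}^t w (t < 0)`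

of Hastings' quasi-adiabatic generator `D(s) = ∫ W(t) e^{itH_s} (∂_s H_s) e^{−itH_s} dt`
(Bachmann–Michalakis–Nachtergaele–Sims, CMP **309** (2012) 835 = arXiv:1102.0842, §2: the function
`W_γ` defined by exactly these two tail integrals in the display preceding their Lemma 2.5 (p. 6 of
the arXiv text), `W_γ ∈ L¹` bounded and odd (Lemma 2.6), and the generator
"`D(s) = ∫ dt W_γ(t) e^{itH(s)} H'(s) e^{−itH(s)}`" (p. 7); used in Michalakis–Zwolak §5.2 through
"the quasi-adiabatic evolution `U(s)` [BMNS:2011, hastings:2010]", arXiv:1109.1588 pp. 10–11).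
This file proves what the stability proof needs about `W`:

* `W` and all its moments are integrable, `∫ |t|^k ‖W(t)‖ dt < ∞` (superpolynomial tails, from
  `|t|^m ‖W(t)‖ ≤ ∫ |s|^m ‖w(s)‖ ds`);
* **the spectral identity** `∫ e^{itΔ} W(t) dt = i/Δ` for `|Δ| ≥ γ` (integration by parts on the
  two half-lines: `W' = −w` away from `0`, jump `−∫ w = −1` at `0`, and `ŵ(Δ) = 0`), which is what
  makes `i[D(s), P(s)] = ∂_s P(s)` (first-order perturbation theory: `⟨ψ_m, ∂_s P ψ_n⟩ =
  ⟨ψ_m, ∂_sH ψ_n⟩/(E_n − E_m)` across the gap);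
* `W` is real-valued when `w` is.

Main statement: `exists_spectralFlowWeight`. No definitions, no named facts (theorems only; the
functions `W₊(t) = ∫_{(t,∞)} w`, `W₋(t) = −∫_{(−∞,t]} w` are written out).
-/

noncomputable section

open MeasureTheory Set Filter Complex SchwartzMap intervalIntegral
open scoped Topology

namespace Literature.MathematicalPhysics.QuantumLattice

section Tails

variable (w : 𝓢(ℝ, ℂ))

/-- `W₊(t) = ∫_{(t,∞)} w = ∫_{(0,∞)} w − ∫₀ᵗ w`. [folklore] -/
theorem integral_Ioi_eq_sub_intervalIntegral (t : ℝ) :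
    ∫ s in Ioi t, w s = (∫ s in Ioi (0 : ℝ), w s) - ∫ s in (0 : ℝ)..t, w s := by
  have hwi : Integrable (fun s => w s) := w.integrable
  have h := integral_interval_add_Ioi (a := 0) (b := t) hwi.integrableOn hwi.integrableOn
  rw [← h]
  ring

/-- `W₋(t) = −∫_{(−∞,t]} w = W₊(t) − ∫ w`. [folklore] -/
theorem neg_integral_Iic_eq (t : ℝ) :
    -∫ s in Iic t, w s = (∫ s in Ioi t, w s) - ∫ s, w s := by
  have hwi : Integrable (fun s => w s) := w.integrable
  rw [← integral_Iic_add_Ioi (b := t) hwi.integrableOn hwi.integrableOn]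
  ring

/-- `−∫_{(−∞,t]} w = ∫_t^0 w − ∫_{(−∞,0]} w`. [folklore] -/
theorem neg_integral_Iic_eq' (t : ℝ) :
    -∫ s in Iic t, w s = (∫ s in t..(0 : ℝ), w s) - ∫ s in Iic (0 : ℝ), w s := by
  have hwi : Integrable (fun s => w s) := w.integrable
  rw [← integral_Iic_sub_Iic (a := t) (b := 0) hwi.integrableOn hwi.integrableOn]
  ring

/-- `W₊' = −w`. [folklore] -/
theorem hasDerivAt_integral_Ioi (t : ℝ) :
    HasDerivAt (fun u : ℝ => ∫ s in Ioi u, w s) (-w t) t := by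
  have hwi : Integrable (fun s => w s) := w.integrable
  have hfun : (fun u : ℝ => ∫ s in Ioi u, w s) =
      fun u => (∫ s in Ioi (0 : ℝ), w s) - ∫ s in (0 : ℝ)..u, w s :=
    funext (integral_Ioi_eq_sub_intervalIntegral w)
  rw [hfun]
  have hV : HasDerivAt (fun u : ℝ => ∫ s in (0 : ℝ)..u, w s) (w t) t :=
    integral_hasDerivAt_right (hwi.intervalIntegrable)
      (w.continuous.stronglyMeasurableAtFilter _ _) w.continuous.continuousAt
  have h := (hasDerivAt_const t (∫ s in Ioi (0 : ℝ), w s)).fun_sub hV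
  simpa using h

/-- `W₋' = −w`. [folklore] -/
theorem hasDerivAt_neg_integral_Iic (t : ℝ) :
    HasDerivAt (fun u : ℝ => -∫ s in Iic u, w s) (-w t) t := by
  have hfun : (fun u : ℝ => -∫ s in Iic u, w s) = fun u => (∫ s in Ioi u, w s) - ∫ s, w s :=
    funext (neg_integral_Iic_eq w)
  rw [hfun]
  have h := (hasDerivAt_integral_Ioi w t).fun_sub (hasDerivAt_const t (∫ s, w s))
  simpa using h

/-- `W₊(t) → 0` as `t → +∞`. [folklore] -/
theorem tendsto_integral_Ioi_atTop :
    Tendsto (fun t : ℝ => ∫ s in Ioi t, w s) atTop (𝓝 0) := by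
  have hwi : Integrable (fun s => w s) := w.integrable
  have h := intervalIntegral_tendsto_integral_Ioi (0 : ℝ) hwi.integrableOn tendsto_id
  have hfun : (fun t : ℝ => ∫ s in Ioi t, w s) =
      fun t => (∫ s in Ioi (0 : ℝ), w s) - ∫ s in (0 : ℝ)..t, w s :=
    funext (integral_Ioi_eq_sub_intervalIntegral w)
  rw [hfun, ← sub_self (∫ s in Ioi (0 : ℝ), w s)]
  exact tendsto_const_nhds.sub h

/-- `W₋(t) → 0` as `t → −∞`. [folklore] -/
theorem tendsto_neg_integral_Iic_atBot :
    Tendsto (fun t : ℝ => -∫ s in Iic t, w s) atBot (𝓝 0) := by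
  have hwi : Integrable (fun s => w s) := w.integrable
  have h := intervalIntegral_tendsto_integral_Iic (0 : ℝ) hwi.integrableOn tendsto_id
  have hfun : (fun t : ℝ => -∫ s in Iic t, w s) =
      fun t => (∫ s in t..(0 : ℝ), w s) - ∫ s in Iic (0 : ℝ), w s :=
    funext (neg_integral_Iic_eq' w)
  rw [hfun, ← sub_self (∫ s in Iic (0 : ℝ), w s)]
  exact h.sub tendsto_const_nhds

/-- **Moment bound for the right tail**: for `t ≥ 0`, `|t|^m ‖W₊(t)‖ ≤ ∫ |s|^m ‖w(s)‖ ds`.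
[folklore] -/
theorem pow_mul_norm_integral_Ioi_le (m : ℕ) {t : ℝ} (ht : 0 ≤ t) :
    |t| ^ m * ‖∫ s in Ioi t, w s‖ ≤ ∫ s, ‖s‖ ^ m * ‖w s‖ := by
  have hwi : Integrable (fun s => w s) := w.integrable
  have hint := w.integrable_pow_mul volume m
  calc |t| ^ m * ‖∫ s in Ioi t, w s‖ ≤ |t| ^ m * ∫ s in Ioi t, ‖w s‖ :=
        mul_le_mul_of_nonneg_left (norm_integral_le_integral_norm _) (by positivity)
    _ = ∫ s in Ioi t, |t| ^ m * ‖w s‖ := by rw [MeasureTheory.integral_const_mul]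
    _ ≤ ∫ s in Ioi t, ‖s‖ ^ m * ‖w s‖ := by
        refine setIntegral_mono_on ((hwi.norm.const_mul _).integrableOn) hint.integrableOn
          measurableSet_Ioi fun s hs => ?_
        refine mul_le_mul_of_nonneg_right (pow_le_pow_left₀ (abs_nonneg t) ?_ m) (norm_nonneg _)
        rw [Real.norm_eq_abs, abs_of_nonneg ht]
        exact (le_of_lt hs).trans (le_abs_self s)
    _ ≤ ∫ s, ‖s‖ ^ m * ‖w s‖ :=
        setIntegral_le_integral hint (Eventually.of_forall fun s => by positivity)

/-- **Moment bound for the left tail**: for `t ≤ 0`, `|t|^m ‖W₋(t)‖ ≤ ∫ |s|^m ‖w(s)‖ ds`.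
[folklore] -/
theorem pow_mul_norm_neg_integral_Iic_le (m : ℕ) {t : ℝ} (ht : t ≤ 0) :
    |t| ^ m * ‖-∫ s in Iic t, w s‖ ≤ ∫ s, ‖s‖ ^ m * ‖w s‖ := by
  have hwi : Integrable (fun s => w s) := w.integrable
  have hint := w.integrable_pow_mul volume m
  rw [norm_neg]
  calc |t| ^ m * ‖∫ s in Iic t, w s‖ ≤ |t| ^ m * ∫ s in Iic t, ‖w s‖ :=
        mul_le_mul_of_nonneg_left (norm_integral_le_integral_norm _) (by positivity)
    _ = ∫ s in Iic t, |t| ^ m * ‖w s‖ := by rw [MeasureTheory.integral_const_mul]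
    _ ≤ ∫ s in Iic t, ‖s‖ ^ m * ‖w s‖ := by
        refine setIntegral_mono_on ((hwi.norm.const_mul _).integrableOn) hint.integrableOn
          measurableSet_Iic fun s hs => ?_
        refine mul_le_mul_of_nonneg_right (pow_le_pow_left₀ (abs_nonneg t) ?_ m) (norm_nonneg _)
        rw [Real.norm_eq_abs, abs_of_nonpos ht, abs_of_nonpos (hs.trans ht)]
        exact neg_le_neg hs
    _ ≤ ∫ s, ‖s‖ ^ m * ‖w s‖ :=
        setIntegral_le_integral hint (Eventually.of_forall fun s => by positivity)

end Tails

/-! ### Integrability of the tails -/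

section Integrable

variable (w : 𝓢(ℝ, ℂ))

/-- `W₊` is integrable on `(0, ∞)` (superpolynomial tails). [folklore] -/
theorem integrableOn_integral_Ioi :
    IntegrableOn (fun t : ℝ => ∫ s in Ioi t, w s) (Ioi 0) := by
  rw [← integrable_indicator_iff measurableSet_Ioi]
  set f : ℝ → ℂ := (Ioi (0 : ℝ)).indicator fun t : ℝ => ∫ s in Ioi t, w s with hf
  have hcont : Continuous fun t : ℝ => ∫ s in Ioi t, w s :=
    continuous_iff_continuousAt.mpr fun t => (hasDerivAt_integral_Ioi w t).continuousAt
  have hmeas : AEStronglyMeasurable f volume :=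
    (hcont.aestronglyMeasurable).indicator measurableSet_Ioi
  have hbound : ∀ m : ℕ, ∀ t : ℝ, ‖t‖ ^ m * ‖f t‖ ≤ ∫ s, ‖s‖ ^ m * ‖w s‖ := by
    intro m t
    by_cases ht : t ∈ Ioi (0 : ℝ)
    · rw [hf, indicator_of_mem ht, Real.norm_eq_abs]
      exact pow_mul_norm_integral_Ioi_le w m (le_of_lt ht)
    · rw [hf, indicator_of_notMem ht, norm_zero, mul_zero]
      exact integral_nonneg fun s => by positivity
  have h0 : ∀ t : ℝ, ‖f t‖ ≤ ∫ s, ‖s‖ ^ 0 * ‖w s‖ := fun t => by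
    simpa using hbound 0 t
  have h := integrable_of_le_of_pow_mul_le (μ := volume) (k := 0) h0
    (hbound (0 + (volume : Measure ℝ).integrablePower)) hmeas
  simp only [pow_zero, one_mul] at h
  exact (integrable_norm_iff hmeas).mp h

/-- `W₋` is integrable on `(−∞, 0]`. [folklore] -/
theorem integrableOn_neg_integral_Iic :
    IntegrableOn (fun t : ℝ => -∫ s in Iic t, w s) (Iic 0) := by
  rw [← integrable_indicator_iff measurableSet_Iic]
  set f : ℝ → ℂ := (Iic (0 : ℝ)).indicator fun t : ℝ => -∫ s in Iic t, w s with hf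
  have hcont : Continuous fun t : ℝ => -∫ s in Iic t, w s :=
    continuous_iff_continuousAt.mpr fun t => (hasDerivAt_neg_integral_Iic w t).continuousAt
  have hmeas : AEStronglyMeasurable f volume :=
    (hcont.aestronglyMeasurable).indicator measurableSet_Iic
  have hbound : ∀ m : ℕ, ∀ t : ℝ, ‖t‖ ^ m * ‖f t‖ ≤ ∫ s, ‖s‖ ^ m * ‖w s‖ := by
    intro m t
    by_cases ht : t ∈ Iic (0 : ℝ)
    · rw [hf, indicator_of_mem ht, Real.norm_eq_abs]
      exact pow_mul_norm_neg_integral_Iic_le w m ht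
    · rw [hf, indicator_of_notMem ht, norm_zero, mul_zero]
      exact integral_nonneg fun s => by positivity
  have h0 : ∀ t : ℝ, ‖f t‖ ≤ ∫ s, ‖s‖ ^ 0 * ‖w s‖ := fun t => by
    simpa using hbound 0 t
  have h := integrable_of_le_of_pow_mul_le (μ := volume) (k := 0) h0
    (hbound (0 + (volume : Measure ℝ).integrablePower)) hmeas
  simp only [pow_zero, one_mul] at h
  exact (integrable_norm_iff hmeas).mp h

end Integrable

/-! ### Integration by parts on the two half-lines -/

section Parts

variable (w : 𝓢(ℝ, ℂ))

/-- Derivative of the oscillating factor: `d/dt e^{itΔ} = (Δ i) e^{itΔ}`. [folklore] -/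
theorem hasDerivAt_cexp_mul_I (Δ t : ℝ) :
    HasDerivAt (fun u : ℝ => cexp (u * Δ * I)) (Δ * I * cexp (t * Δ * I)) t := by
  have h1 : HasDerivAt (fun u : ℝ => ((u * Δ : ℝ) : ℂ)) ((Δ : ℝ) : ℂ) t := by
    have := ((hasDerivAt_id t).mul_const Δ).ofReal_comp
    simpa using this
  have h2 : HasDerivAt (fun u : ℝ => ((u * Δ : ℝ) : ℂ) * I) ((Δ : ℂ) * I) t := h1.mul_const I
  have h3 := h2.cexp
  have hfun : (fun u : ℝ => cexp (((u * Δ : ℝ) : ℂ) * I)) = fun u : ℝ => cexp (u * Δ * I) := by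
    funext u; push_cast; ring_nf
  rw [hfun] at h3
  convert h3 using 1
  push_cast
  ring

/-- The oscillating factor has norm one. [folklore] -/
theorem norm_cexp_mul_I (t Δ : ℝ) : ‖cexp (t * Δ * I)‖ = 1 := by
  rw [show (t : ℂ) * Δ * I = ((t * Δ : ℝ) : ℂ) * I by push_cast; ring]
  exact norm_exp_ofReal_mul_I _

/-- **Right half-line.** For `Δ ≠ 0`,
`∫_{(0,∞)} e^{itΔ} W₊(t) dt = −W₊(0)/(iΔ) + (iΔ)⁻¹ ∫_{(0,∞)} e^{itΔ} w(t) dt`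
(integration by parts, `W₊' = −w`, `W₊(∞) = 0`). [folklore] -/
theorem integral_Ioi_cexp_mul_integral_Ioi {Δ : ℝ} (hΔ : Δ ≠ 0) :
    ∫ t in Ioi (0 : ℝ), cexp (t * Δ * I) * ∫ s in Ioi t, w s =
      -(∫ s in Ioi (0 : ℝ), w s) / (Δ * I) +
        (Δ * I)⁻¹ * ∫ t in Ioi (0 : ℝ), cexp (t * Δ * I) * w t := by
  have hΔc : (Δ : ℂ) ≠ 0 := by exact_mod_cast hΔ
  have hc : (Δ : ℂ) * I ≠ 0 := mul_ne_zero hΔc I_ne_zero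
  set Wp : ℝ → ℂ := fun t => ∫ s in Ioi t, w s with hWp
  set G : ℝ → ℂ := fun t => Wp t * cexp (t * Δ * I) / (Δ * I) with hG
  set G' : ℝ → ℂ := fun t => -(w t * cexp (t * Δ * I)) / (Δ * I) + cexp (t * Δ * I) * Wp t with hG'
  have hderiv : ∀ t, HasDerivAt G (G' t) t := by
    intro t
    have h1 := (hasDerivAt_integral_Ioi w t).mul (hasDerivAt_cexp_mul_I Δ t)
    have h2 := h1.div_const ((Δ : ℂ) * I)
    refine h2.congr_deriv ?_
    simp only [hG', hWp]
    field_simp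
  have hcontG : Continuous G := continuous_iff_continuousAt.mpr fun t => (hderiv t).continuousAt
  -- integrability of `G'` on `(0, ∞)`
  have hi1 : IntegrableOn (fun t : ℝ => cexp (t * Δ * I) * w t) (Ioi 0) := by
    refine (w.integrable.norm.mono' ?_ (Eventually.of_forall fun t => ?_)).integrableOn
    · exact ((by fun_prop : Continuous fun t : ℝ => cexp (t * Δ * I)).mul w.continuous)
        |>.aestronglyMeasurable
    · rw [norm_mul, norm_cexp_mul_I, one_mul]
  have hi2 : IntegrableOn (fun t : ℝ => cexp (t * Δ * I) * Wp t) (Ioi 0) := by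
    have h := integrableOn_integral_Ioi w
    refine (h.norm.mono' ?_ (Eventually.of_forall fun t => ?_))
    · exact ((by fun_prop : Continuous fun t : ℝ => cexp (t * Δ * I)).mul
        (continuous_iff_continuousAt.mpr fun t => (hasDerivAt_integral_Ioi w t).continuousAt))
        |>.aestronglyMeasurable
    · rw [norm_mul, norm_cexp_mul_I, one_mul]
  have hG'int : IntegrableOn G' (Ioi 0) := by
    have h3 : IntegrableOn (fun t : ℝ => -(w t * cexp (t * Δ * I)) / (Δ * I)) (Ioi 0) := by
      have h := (hi1.neg.div_const ((Δ : ℂ) * I))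
      exact h.congr (Eventually.of_forall fun t => by simp only [Pi.neg_apply]; ring)
    exact h3.add hi2
  -- the limit at `+∞`
  have hlim : Tendsto G atTop (𝓝 0) := by
    rw [tendsto_zero_iff_norm_tendsto_zero]
    have hnorm : ∀ t, ‖G t‖ = ‖Wp t‖ / |Δ| := fun t => by
      simp only [hG, norm_div, norm_mul, norm_cexp_mul_I, mul_one, Complex.norm_I,
        Complex.norm_real, Real.norm_eq_abs]
    simp only [hnorm]
    have h := (tendsto_integral_Ioi_atTop w).norm
    rw [norm_zero] at h
    simpa using h.div_const |Δ|
  have hFTC := integral_Ioi_of_hasDerivAt_of_tendsto (hcontG.continuousWithinAt)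
    (fun t _ => hderiv t) hG'int hlim
  -- unfold `G'` and solve for the wanted integral
  have hsplit : ∫ t in Ioi (0 : ℝ), G' t =
      -((Δ * I)⁻¹ * ∫ t in Ioi (0 : ℝ), cexp (t * Δ * I) * w t) +
        ∫ t in Ioi (0 : ℝ), cexp (t * Δ * I) * Wp t := by
    rw [hG', integral_add _ hi2]
    · congr 1
      rw [← MeasureTheory.integral_const_mul, ← MeasureTheory.integral_neg]
      refine integral_congr_ae (Eventually.of_forall fun t => ?_)
      simp only
      field_simp
    · have h := (hi1.neg.div_const ((Δ : ℂ) * I))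
      exact h.congr (Eventually.of_forall fun t => by simp only [Pi.neg_apply]; ring)
  rw [hsplit] at hFTC
  have hG0 : G 0 = Wp 0 / (Δ * I) := by simp [hG]
  rw [hG0, zero_sub] at hFTC
  -- `hFTC : -(c⁻¹ ∫ w e) + ∫ Wp e = -(Wp 0 / c)`
  have : ∫ t in Ioi (0 : ℝ), cexp (t * Δ * I) * Wp t =
      -(Wp 0 / (Δ * I)) + (Δ * I)⁻¹ * ∫ t in Ioi (0 : ℝ), cexp (t * Δ * I) * w t := by
    linear_combination hFTC
  rw [this, neg_div]

/-- **Left half-line.** For `Δ ≠ 0`,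
`∫_{(−∞,0]} e^{itΔ} W₋(t) dt = W₋(0)/(iΔ) + (iΔ)⁻¹ ∫_{(−∞,0]} e^{itΔ} w(t) dt`
(integration by parts, `W₋' = −w`, `W₋(−∞) = 0`). [folklore] -/
theorem integral_Iic_cexp_mul_neg_integral_Iic {Δ : ℝ} (hΔ : Δ ≠ 0) :
    ∫ t in Iic (0 : ℝ), cexp (t * Δ * I) * (-∫ s in Iic t, w s) =
      (-∫ s in Iic (0 : ℝ), w s) / (Δ * I) +
        (Δ * I)⁻¹ * ∫ t in Iic (0 : ℝ), cexp (t * Δ * I) * w t := by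
  have hΔc : (Δ : ℂ) ≠ 0 := by exact_mod_cast hΔ
  have hc : (Δ : ℂ) * I ≠ 0 := mul_ne_zero hΔc I_ne_zero
  set Wm : ℝ → ℂ := fun t => -∫ s in Iic t, w s with hWm
  set G : ℝ → ℂ := fun t => Wm t * cexp (t * Δ * I) / (Δ * I) with hG
  set G' : ℝ → ℂ := fun t => -(w t * cexp (t * Δ * I)) / (Δ * I) + cexp (t * Δ * I) * Wm t with hG'
  have hderiv : ∀ t, HasDerivAt G (G' t) t := by
    intro t
    have h1 := (hasDerivAt_neg_integral_Iic w t).mul (hasDerivAt_cexp_mul_I Δ t)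
    have h2 := h1.div_const ((Δ : ℂ) * I)
    refine h2.congr_deriv ?_
    simp only [hG', hWm]
    field_simp
  have hcontG : Continuous G := continuous_iff_continuousAt.mpr fun t => (hderiv t).continuousAt
  have hi1 : IntegrableOn (fun t : ℝ => cexp (t * Δ * I) * w t) (Iic 0) := by
    refine (w.integrable.norm.mono' ?_ (Eventually.of_forall fun t => ?_)).integrableOn
    · exact ((by fun_prop : Continuous fun t : ℝ => cexp (t * Δ * I)).mul w.continuous)
        |>.aestronglyMeasurable
    · rw [norm_mul, norm_cexp_mul_I, one_mul]
  have hi2 : IntegrableOn (fun t : ℝ => cexp (t * Δ * I) * Wm t) (Iic 0) := by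
    have h := integrableOn_neg_integral_Iic w
    refine (h.norm.mono' ?_ (Eventually.of_forall fun t => ?_))
    · exact ((by fun_prop : Continuous fun t : ℝ => cexp (t * Δ * I)).mul
        (continuous_iff_continuousAt.mpr fun t => (hasDerivAt_neg_integral_Iic w t).continuousAt))
        |>.aestronglyMeasurable
    · rw [norm_mul, norm_cexp_mul_I, one_mul]
  have hG'int : IntegrableOn G' (Iic 0) := by
    have h3 : IntegrableOn (fun t : ℝ => -(w t * cexp (t * Δ * I)) / (Δ * I)) (Iic 0) := by
      have h := (hi1.neg.div_const ((Δ : ℂ) * I))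
      exact h.congr (Eventually.of_forall fun t => by simp only [Pi.neg_apply]; ring)
    exact h3.add hi2
  have hlim : Tendsto G atBot (𝓝 0) := by
    rw [tendsto_zero_iff_norm_tendsto_zero]
    have hnorm : ∀ t, ‖G t‖ = ‖Wm t‖ / |Δ| := fun t => by
      simp only [hG, norm_div, norm_mul, norm_cexp_mul_I, mul_one, Complex.norm_I,
        Complex.norm_real, Real.norm_eq_abs]
    simp only [hnorm, hWm, norm_neg]
    have h := (tendsto_neg_integral_Iic_atBot w).norm
    rw [norm_zero] at h
    simp only [norm_neg] at h
    simpa using h.div_const |Δ|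
  have hFTC := integral_Iic_of_hasDerivAt_of_tendsto (hcontG.continuousWithinAt)
    (fun t _ => hderiv t) hG'int hlim
  have hsplit : ∫ t in Iic (0 : ℝ), G' t =
      -((Δ * I)⁻¹ * ∫ t in Iic (0 : ℝ), cexp (t * Δ * I) * w t) +
        ∫ t in Iic (0 : ℝ), cexp (t * Δ * I) * Wm t := by
    rw [hG', integral_add _ hi2]
    · congr 1
      rw [← MeasureTheory.integral_const_mul, ← MeasureTheory.integral_neg]
      refine integral_congr_ae (Eventually.of_forall fun t => ?_)
      simp only
      field_simp
    · have h := (hi1.neg.div_const ((Δ : ℂ) * I))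
      exact h.congr (Eventually.of_forall fun t => by simp only [Pi.neg_apply]; ring)
  rw [hsplit] at hFTC
  have hG0 : G 0 = Wm 0 / (Δ * I) := by simp [hG]
  rw [hG0, sub_zero] at hFTC
  linear_combination hFTC

end Parts

/-! ### The weight `W` -/

section Weight

/-- **Existence of the spectral-flow weight.** For every `γ > 0` there is a function
`W : ℝ → ℂ` (namely `W = ∫_t^∞ w` on `t ≥ 0` and `W = −∫_{−∞}^t w` on `t < 0` for a filter `w` of
`exists_schwartz_filter`) such that
* all moments are bounded and integrable: `|t|^m ‖W(t)‖ ≤ M_m` and `∫ |t|^k ‖W(t)‖ dt < ∞` for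
  all `m, k` (superpolynomial decay), in particular `W ∈ L¹`;
* **spectral identity**: `∫ e^{itΔ} W(t) dt = i/Δ` whenever `|Δ| ≥ γ`;
* `W` is real-valued.
This is the weight of Hastings' quasi-adiabatic generator
`D(s) = ∫ W(t) e^{itH_s} (∂_sH_s) e^{−itH_s} dt` as constructed in Bachmann–Michalakis–
Nachtergaele–Sims, CMP **309** (2012) 835 = arXiv:1102.0842, §2: `W_γ(t) = ∫_t^∞ w_γ` (`t ≥ 0`),
`−∫_{−∞}^t w_γ` (`t < 0`) (display before Lemma 2.5, p. 6), Lemma 2.6 (`W_γ ∈ L¹`, bounded), and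
the spectral computation "`i ∫ dt w_γ(t) ∫₀ᵗ du e^{±iu(λ−μ)} = … = ∓ 1/(λ−μ)`" for `|λ − μ| > γ`
(p. 6), of which the identity here is the integrated-by-parts form; invoked by Michalakis–Zwolak
§5.2 ("the quasi-adiabatic evolution `U(s)` [BMNS:2011, hastings:2010]", arXiv:1109.1588
pp. 10–11). Here with Schwartz (superpolynomial) rather than near-exponential decay.
[cite: BachmannMichalakisNachtergaeleSims2012, §2 Lemma 2.6 and the definition of `W_γ` (arXiv:1102.0842 p. 6)] -/
theorem exists_spectralFlowWeight {γ : ℝ} (hγ : 0 < γ) :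
    ∃ W : ℝ → ℂ, AEStronglyMeasurable W volume ∧
      (∀ m : ℕ, ∃ M : ℝ, ∀ t : ℝ, |t| ^ m * ‖W t‖ ≤ M) ∧
      (∀ k : ℕ, Integrable fun t : ℝ => ‖t‖ ^ k * ‖W t‖) ∧ Integrable W ∧
      (∀ Δ : ℝ, γ ≤ |Δ| → ∫ t : ℝ, cexp (t * Δ * I) * W t = I / Δ) ∧
      (∀ t : ℝ, starRingEnd ℂ (W t) = W t) := by
  obtain ⟨w, hw1, hwf, hwreal⟩ := exists_schwartz_filter hγ
  have hwi : Integrable (fun s => w s) := w.integrable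
  set Wp : ℝ → ℂ := fun t => ∫ s in Ioi t, w s with hWp
  set Wm : ℝ → ℂ := fun t => -∫ s in Iic t, w s with hWm
  set W : ℝ → ℂ := fun t => (Ici (0 : ℝ)).indicator Wp t + (Iio (0 : ℝ)).indicator Wm t with hW
  have hWpos : ∀ t : ℝ, 0 ≤ t → W t = Wp t := fun t ht => by
    have h1 : t ∈ Ici (0 : ℝ) := mem_Ici.mpr ht
    have h2 : t ∉ Iio (0 : ℝ) := fun h => absurd (mem_Iio.mp h) (not_lt.mpr ht)
    simp only [hW, indicator_of_mem h1, indicator_of_notMem h2, add_zero]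
  have hWneg : ∀ t : ℝ, t < 0 → W t = Wm t := fun t ht => by
    have h1 : t ∉ Ici (0 : ℝ) := fun h => absurd (mem_Ici.mp h) (not_le.mpr ht)
    have h2 : t ∈ Iio (0 : ℝ) := mem_Iio.mpr ht
    simp only [hW, indicator_of_notMem h1, indicator_of_mem h2, zero_add]
  -- continuity of the two branches and measurability of `W`
  have hcp : Continuous Wp :=
    continuous_iff_continuousAt.mpr fun t => (hasDerivAt_integral_Ioi w t).continuousAt
  have hcm : Continuous Wm :=
    continuous_iff_continuousAt.mpr fun t => (hasDerivAt_neg_integral_Iic w t).continuousAt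
  have hmeas : AEStronglyMeasurable W volume :=
    (hcp.aestronglyMeasurable.indicator measurableSet_Ici).add
      (hcm.aestronglyMeasurable.indicator measurableSet_Iio)
  -- moment bounds
  have hmom : ∀ m : ℕ, ∀ t : ℝ, |t| ^ m * ‖W t‖ ≤ ∫ s, ‖s‖ ^ m * ‖w s‖ := by
    intro m t
    rcases le_or_gt 0 t with ht | ht
    · rw [hWpos t ht]
      exact pow_mul_norm_integral_Ioi_le w m ht
    · rw [hWneg t ht]
      exact pow_mul_norm_neg_integral_Iic_le w m ht.le
  have hint : ∀ k : ℕ, Integrable fun t : ℝ => ‖t‖ ^ k * ‖W t‖ := by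
    intro k
    refine integrable_of_le_of_pow_mul_le (μ := volume) (C₁ := ∫ s, ‖s‖ ^ 0 * ‖w s‖)
      (C₂ := ∫ s, ‖s‖ ^ (k + (volume : Measure ℝ).integrablePower) * ‖w s‖)
      (fun t => by simpa using hmom 0 t) (fun t => ?_) hmeas
    rw [Real.norm_eq_abs]
    exact hmom _ t
  have hintW : Integrable W := by
    have h := hint 0
    simp only [pow_zero, one_mul] at h
    exact (integrable_norm_iff hmeas).mp h
  refine ⟨W, hmeas, fun m => ⟨_, hmom m⟩, hint, hintW, fun Δ hΔ => ?_, fun t => ?_⟩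
  · -- the spectral identity
    have hΔ0 : Δ ≠ 0 := fun h => by
      rw [h, abs_zero] at hΔ
      exact absurd hΔ (not_le.mpr hγ)
    have hΔc : (Δ : ℂ) ≠ 0 := by exact_mod_cast hΔ0
    have hc : (Δ : ℂ) * I ≠ 0 := mul_ne_zero hΔc I_ne_zero
    -- integrability of the integrand and splitting at `0`
    have hf : Integrable fun t : ℝ => cexp (t * Δ * I) * W t := by
      refine hintW.norm.mono' ?_ (Eventually.of_forall fun t => ?_)
      · exact ((by fun_prop : Continuous fun t : ℝ => cexp (t * Δ * I)).aestronglyMeasurable.mul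
          hmeas)
      · rw [norm_mul, norm_cexp_mul_I, one_mul]
    rw [← integral_Iic_add_Ioi (b := (0 : ℝ)) hf.integrableOn hf.integrableOn]
    -- on `(0, ∞)` the weight is `W₊`, on `(−∞, 0)` it is `W₋`
    have hIoi : ∫ t in Ioi (0 : ℝ), cexp (t * Δ * I) * W t =
        ∫ t in Ioi (0 : ℝ), cexp (t * Δ * I) * Wp t :=
      setIntegral_congr_fun measurableSet_Ioi fun t ht => by
        simp only [hWpos t (le_of_lt ht)]
    have hIic : ∫ t in Iic (0 : ℝ), cexp (t * Δ * I) * W t =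
        ∫ t in Iic (0 : ℝ), cexp (t * Δ * I) * Wm t := by
      rw [integral_Iic_eq_integral_Iio, integral_Iic_eq_integral_Iio]
      exact setIntegral_congr_fun measurableSet_Iio fun t ht => by
        simp only [hWneg t ht]
    rw [hIoi, hIic, integral_Ioi_cexp_mul_integral_Ioi w hΔ0,
      integral_Iic_cexp_mul_neg_integral_Iic w hΔ0]
    -- collect: `(−∫_{Iic} w − ∫_{Ioi} w)/(Δ i) + (Δ i)⁻¹ ∫ e^{itΔ} w = −1/(Δ i)`
    have hsumw : (∫ s in Iic (0 : ℝ), w s) + ∫ s in Ioi (0 : ℝ), w s = 1 := by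
      rw [integral_Iic_add_Ioi (b := (0 : ℝ)) hwi.integrableOn hwi.integrableOn]
      exact hw1
    have hwe : Integrable fun t : ℝ => cexp (t * Δ * I) * w t := by
      refine hwi.norm.mono' ?_ (Eventually.of_forall fun t => ?_)
      · exact ((by fun_prop : Continuous fun t : ℝ => cexp (t * Δ * I)).mul w.continuous)
          |>.aestronglyMeasurable
      · rw [norm_mul, norm_cexp_mul_I, one_mul]
    have hsume : (∫ t in Iic (0 : ℝ), cexp (t * Δ * I) * w t) +
        ∫ t in Ioi (0 : ℝ), cexp (t * Δ * I) * w t = 0 := by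
      rw [integral_Iic_add_Ioi (b := (0 : ℝ)) hwe.integrableOn hwe.integrableOn]
      exact hwf Δ hΔ
    have hI : -1 / ((Δ : ℂ) * I) = I / Δ := by
      rw [div_eq_div_iff hc hΔc]
      ring_nf
      rw [I_sq]
      ring
    rw [← hI]
    linear_combination (-(1 : ℂ) / (Δ * I)) * hsumw + (((Δ : ℂ) * I)⁻¹) * hsume
  · -- real values
    rcases le_or_gt 0 t with ht | ht
    · rw [hWpos t ht, hWp]
      simp only
      rw [← integral_conj]
      exact integral_congr_ae (Eventually.of_forall fun s => hwreal s)
    · rw [hWneg t ht, hWm]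
      simp only [map_neg]
      rw [← integral_conj]
      exact congrArg Neg.neg (integral_congr_ae (Eventually.of_forall fun s => hwreal s))

end Weight

end Literature.MathematicalPhysics.QuantumLattice
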